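import Summits.BirchSwinnertonDyer.BirchSwinnertonDyer.Theorems.SignedLowerHalvesSmallImageLowerHalfBothSignsRttSplitCloser
import Summits.BirchSwinnertonDyer.BirchSwinnertonDyer.Theorems.EisensteinPrimesMazurMCOnCellBKernelCertP13TwoUnits
import Summits.BirchSwinnertonDyer.BirchSwinnertonDyer.Theorems.Rank1ResidualIntModelReduction
import Literature.NumberTheory.EllipticCurves.SupersingularIrreducibleProofs
import HarnessLib

/-!
# Route `SignedLowerHalves`, crux L `SmallImageLowerHalfBothSigns` (item stmt-BirchSwinnertonDyer-23599), line `rtt_w3`: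
# SPLIT-CLOSER RECORDS, part 02 — crux L's body at the tier-T2 pairs 245456b1 @ 7, 245456c1 @ 7, 353925ce1 @ 7, 232544i1 @ 11 from print + TWO displayed two-engine
# Mazur–Tate rows `(μ, λ)(L^±_p) = (0, 2)` + a kernel split-multiplicative certificate — NO partner, NO floor binder

Width seat `bsd-line-slh-p3-w3` g14 under LEAD `cruxlead-stmt-BirchSwinnertonDyer-23599` g3 (cell `bsd-ssimc`); `--supports
stmt-BirchSwinnertonDyer-23599 --as helper`; THEOREMS ONLY; PER PAIR; closes nothing class-wide; BSD is proved for no curve (every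
published input is a named-fact HYPOTHESIS).

WHAT IS RECORDED. The LEAD's tier T2 (pairs WITHOUT a CM elliptic-curve partner) at `p ≥ 5` consists of 10 pairs (6 @5, 3 @7, 1 @11 after
g13's unit-zone records), carried on the board as «research residue ENG_T3 / PSB_T3». NINE of them are rank-`0` pairs with
`(μ, λ)(L^±_p) = (0, 2)` at BOTH signs — TWO-ENGINE rows of the crux's standing disprover (kit j335262 `cdisprove-…-23599`, PREREG `gvkan2`
839c353487edc3e8; `gvkan2/LAYERS.tsv` sha16 09c04126f37ca31c, engines B = `msengine (lit-g7)+iwlayer` and E = `eclib`, status `2eng`, AGREE;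
evidence #53–#56 on the item): at the EVEN layer `n = 2` (`deg ω_2^− = deg Φ_p(1+T) = p − 1`) `μ(θ_2) = 0, λ(θ_2) = (p − 1) + 2`, and at the
ODD layer `n = 1` (`deg ω_1^+ = 0`) `μ(θ_1) = 0, λ(θ_1) = 2` — and each has exactly ONE multiplicative prime `q`, with `ord_q(Δ) = p` and
SPLIT reduction (Cremona `∏c` = 14, 14, 56, 22; kernel certificate below: a root of the node-tangent quadratic mod `q`). There crux L's body is the
SPLIT CLOSER `classX7_and_forall_kobayashiLowerDivisibility_of_split_of_mazurTateRows` (file `…RttSplitCloser`, this seat; mechanism = w3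
g5's general-`p` λ-two closer `…LambdaLowerThreeNsTamagawa.forall_kobayashiLowerDivisibility_of_certs_of_finite_of_afe_of_not_surj_of_split`):
PRINT BY NAME `hJ h12 h41` (Kobayashi), `hK13` (B. D. Kim 2013 Cor 3.15), `hK08` (B. D. Kim 2008 Thm 3.12, the AFE at `p > 3`), `h5 h3`,
`hmod` (modularity), `hGZK` (finiteness of `Sel_{p^∞}` at `r_an = 0`); displayed per pair: `r_an = 0` (Cremona), the two rows (`hrowE`,
`hrowO`), and `¬ Surj W p` (`hs` — crux L's own premise; k3-c4 census image `pNn`; the tree has no partner-free `pNn` certificate at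
`p ≥ 5`). Kernel-decided per pair: `p ∤ Δ`, `#Ẽ(𝔽_p) = p + 1` (`a_p = 0`), an additive prime (X7), `q ∣ Δ`, `q ∤ c₄`, the node-tangent root.
The tenth T2 pair at `p ≥ 5`, `431433o1 @ 5`, has rows `(0, 4)`, `(0, 6)` and is NOT reached by the λ-two closer.

References: [Kobayashi2003] Conjecture (p. 2), Thm. 1.2, 4.1, 6.2–7.3; [KimBD2008MRL] Thm. 3.12 (p. 93); [BDKim2013] Cor. 3.15;
[Pollack2003] Prop. 6.9, 6.10, 6.18; [Serre1972] §2.4 Prop. 15; [SilvermanAEC2009] VII.5 Prop. 5.1; [Darmon2004] Thm. 3.22;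
[Cremona2006] Table 1 (labels 245456b1 @ 7, 245456c1 @ 7, 353925ce1 @ 7, 232544i1 @ 11).
-/

set_option autoImplicit false
-- D-0017: single-problem summit, the namespace repeats the problem name by design.
set_option linter.dupNamespace false
noncomputable section

open scoped Classical MatrixGroups ModularForm

open CongruenceSubgroup WeierstrassCurve Literature.NumberTheory.EllipticCurves
  Literature.NumberTheory.EllipticCurves.ModularForms
  Literature.NumberTheory.EllipticCurves.Kobayashi2003 ZpExtension
  Literature.NumberTheory.EllipticCurves.GreenbergVatsal2000
  Literature.NumberTheory.EllipticCurves.Rank1Residual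
  Literature.NumberTheory.EllipticCurves.Rank1Residual.Typed
  Literature.NumberTheory.EllipticCurves.Rank1Residual.X11RankOneCertificates
  Summit.BirchSwinnertonDyer.BirchSwinnertonDyer.Rank1Residual.IntModel
  Summit.BirchSwinnertonDyer.BirchSwinnertonDyer.Rank1Residual.X11RankOne
  Summit.BirchSwinnertonDyer.Rank1Residual.X11b
  Summit.BirchSwinnertonDyer.Rank1Residual.X9
  Summit.BirchSwinnertonDyer.Rank1Residual.X1
  Summit.BirchSwinnertonDyer.Rank1Residual.X1.MuLambda
  Summit.BirchSwinnertonDyer.Rank1Residual.Supersingular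

namespace Summit.BirchSwinnertonDyer.BirchSwinnertonDyer.Theorems.SmallImageRttOneSided

/-! ### §1 Kernel point counts (`a_p = 0`; the counts of 207616g1/h1, 301824bp1 are k3-c4 g9`s `card_lam25_…`, imported) -/

/-- `#{Ẽ(𝔽_7)} = 8` for the Cremona model of `245456b1` = `[0, 1, 0, -85980133, 623470851987]` (`a_7 = 0`: good SUPERSINGULAR; kernel count). [cite: Cremona2006, Table 1 (Cremona label 245456b1)] -/
theorem card_t245456b1_7 :
    Nat.card (((⟨0, 1, 0, -85980133, 623470851987⟩ : WeierstrassCurve ℤ).map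
      (Int.castRingHom (ZMod 7))).toAffine.Point) = 8 := by
  rw [@WeierstrassCurve.natCard_point_eq_one_add_card (ZMod 7) (@ZMod.instField 7 ⟨by norm_num⟩) _ _ _
    (by decide +kernel), @card_sol_eq_sum_euler (ZMod 7) (@ZMod.instField 7 ⟨by norm_num⟩) _ _
    (by rw [ZMod.ringChar_zmod_n]; decide), ZMod.card]
  decide +kernel

/-- `#{Ẽ(𝔽_7)} = 8` for the Cremona model of `245456c1` = `[0, 1, 0, -162533, -51299309]` (`a_7 = 0`: good SUPERSINGULAR; kernel count). [cite: Cremona2006, Table 1 (Cremona label 245456c1)] -/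
theorem card_t245456c1_7 :
    Nat.card (((⟨0, 1, 0, -162533, -51299309⟩ : WeierstrassCurve ℤ).map
      (Int.castRingHom (ZMod 7))).toAffine.Point) = 8 := by
  rw [@WeierstrassCurve.natCard_point_eq_one_add_card (ZMod 7) (@ZMod.instField 7 ⟨by norm_num⟩) _ _ _
    (by decide +kernel), @card_sol_eq_sum_euler (ZMod 7) (@ZMod.instField 7 ⟨by norm_num⟩) _ _
    (by rw [ZMod.ringChar_zmod_n]; decide), ZMod.card]
  decide +kernel

/-- `#{Ẽ(𝔽_7)} = 8` for the Cremona model of `353925ce1` = `[0, 0, 1, 147741000, 99524485156]` (`a_7 = 0`: good SUPERSINGULAR; kernel count). [cite: Cremona2006, Table 1 (Cremona label 353925ce1)] -/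
theorem card_t353925ce1_7 :
    Nat.card (((⟨0, 0, 1, 147741000, 99524485156⟩ : WeierstrassCurve ℤ).map
      (Int.castRingHom (ZMod 7))).toAffine.Point) = 8 := by
  rw [@WeierstrassCurve.natCard_point_eq_one_add_card (ZMod 7) (@ZMod.instField 7 ⟨by norm_num⟩) _ _ _
    (by decide +kernel), @card_sol_eq_sum_euler (ZMod 7) (@ZMod.instField 7 ⟨by norm_num⟩) _ _
    (by rw [ZMod.ringChar_zmod_n]; decide), ZMod.card]
  decide +kernel

/-- `#{Ẽ(𝔽_11)} = 12` for the Cremona model of `232544i1` = `[0, 0, 0, -6682520, 39157150032]` (`a_11 = 0`: good SUPERSINGULAR; kernel count). [cite: Cremona2006, Table 1 (Cremona label 232544i1)] -/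
theorem card_t232544i1_11 :
    Nat.card (((⟨0, 0, 0, -6682520, 39157150032⟩ : WeierstrassCurve ℤ).map
      (Int.castRingHom (ZMod 11))).toAffine.Point) = 12 := by
  rw [@WeierstrassCurve.natCard_point_eq_one_add_card (ZMod 11) (@ZMod.instField 11 ⟨by norm_num⟩) _ _ _
    (by decide +kernel), @card_sol_eq_sum_euler (ZMod 11) (@ZMod.instField 11 ⟨by norm_num⟩) _ _
    (by rw [ZMod.ringChar_zmod_n]; decide), ZMod.card]
  decide +kernel

/-! ### §2 The split-closer records -/

/-- **Crux L's body at the tier-T2 pair `245456b1 @ 7` by the SPLIT CLOSER — NO partner** (Cremona model `[0, 1, 0, -85980133, 623470851987]`, `N = 245456 = 2⁴·23²·29`, X7 (additive at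
`23`), `a_7 = 0`, mod-`7` image `7Nn` (k3-c4 census; no CM elliptic-curve partner), analytic rank `0`, `#tors = 1`, `∏c = 14`, `#Ш_an = 1`,
`L(E,1)/Ω_E = 14`; ONE multiplicative prime `q = 29`, `ord_q(Δ) = 7`, SPLIT): `ClassX7 W 7 ∧ ∀ ε, KobayashiLowerDivisibility W 7 ε` from print BY NAME
(`hJ h12 h41 hK13 hK08 h5 h3 hmod hGZK`) + displayed `r_an = 0` (`hr`), `¬ Surj W 7` (`hs`) and TWO displayed two-engine Mazur–Tate rows of kit
j335262 (`LAYERS.tsv` rows `245456b1@7`: index 2, even, `μ = 0, λ = 8 = 6 + 2` ⇒ `hrowE`; index 1, odd, `μ = 0, λ = 2 = 0 + 2` ⇒ `hrowO`;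
engines B and E AGREE) ⇒ `(μ, λ)(L^±_7) = (0, 2)`. Kernel-decided: `7 ∤ Δ`, `#Ẽ(𝔽_7) = 8` (`card_t245456b1_7`), `23 ∣ Δ, c₄` (X7), and the split
certificate at `q = 29`: `q ∣ Δ`, `q ∤ c₄`, node-tangent root `t = 2` (`hasSplitMultiplicativeReductionAtPrime_of_natRoot`). Per pair;
CONDITIONAL; nothing booked. [cite: Kobayashi2003, Conjecture (p. 2), Thm. 1.2, Thm. 4.1] [cite: KimBD2008MRL, Thm. 3.12 (p. 93)]
[cite: BDKim2013, Cor. 3.15 (p. 199)] [cite: Pollack2003, Prop. 6.18] [cite: SilvermanAEC2009, VII.5 Prop. 5.1(b)]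
[cite: Cremona2006, Table 1 (Cremona label 245456b1)] -/
theorem forall_kobayashiLowerDivisibility_t245456b1_7_of_split_of_mazurTateRows
    (hJ : thm62_63_73_signedColemanKato_zetaJoint) (h12 : thm12_signedSelmerDual_finite_torsion)
    (h41 : thm41_signedCharIdeal_divisibility) (hK13 : BDKim2013.cor315_signedCharValue_rankZero)
    (hK08 : Kim2008.thm312_signedSelmerDual_charIdeal_map_invol)
    (h5 : realPeriodRat_eq_unit_mul_plusPeriod) (h3 : realPeriodRat_eq_unit_mul_plusPeriod_three)
    (hmod : exists_isNewformOf) (hGZK : rank_eq_analyticRank_of_analyticRank_le_one)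
    (W : WeierstrassCurve ℚ) [W.IsElliptic] [W.IsGloballyMinimal] [Fact (Nat.Prime 7)] (hW : W = ⟨0, 1, 0, -85980133, 623470851987⟩)
    (hs : ¬ Surj W 7) (hr : W.analyticRank = 0)
    (hrowE : ∀ [NeZero (W.conductorNorm ℤ)] (f : CuspForm (Gamma0 (W.conductorNorm ℤ)) 2), IsNewformOf W f →
      ∃ Θ : IwasawaAlgebra 7, iwasawaToPowerSeries 7 Θ =
          ((mazurTateElement f 7 2).map (algebraMap ℚ ℚ_[7]) : PowerSeries ℚ_[7]) ∧
        Θ ≠ 0 ∧ mu Θ = 0 ∧ lam Θ = (cyclotomicOmegaMinus 7 2).natDegree + 2)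
    (hrowO : ∀ [NeZero (W.conductorNorm ℤ)] (f : CuspForm (Gamma0 (W.conductorNorm ℤ)) 2), IsNewformOf W f →
      ∃ Θ : IwasawaAlgebra 7, iwasawaToPowerSeries 7 Θ =
          ((mazurTateElement f 7 1).map (algebraMap ℚ ℚ_[7]) : PowerSeries ℚ_[7]) ∧
        Θ ≠ 0 ∧ mu Θ = 0 ∧ lam Θ = (cyclotomicOmegaPlus 7 1).natDegree + 2) :
    ClassX7 W 7 ∧ ∀ ε : ℤˣ, KobayashiLowerDivisibility W 7 ε := by
  have hIW : integralModelInt W = ⟨0, 1, 0, -85980133, 623470851987⟩ :=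
    integralModelInt_eq_of_map_eq _ (by rw [hW]; ext <;> simp [WeierstrassCurve.map])
  have hΔ : (⟨0, 1, 0, -85980133, 623470851987⟩ : WeierstrassCurve ℤ).Δ = discOf [0, 1, 0, -85980133, 623470851987] :=
    intCurve_Δ 0 1 0 (-85980133) 623470851987
  have hc₄ : (⟨0, 1, 0, -85980133, 623470851987⟩ : WeierstrassCurve ℤ).c₄ = c4Of [0, 1, 0, -85980133, 623470851987] :=
    intCurve_c₄ 0 1 0 (-85980133) 623470851987
  have hgood : W.HasGoodReductionAtPrime 7 :=
    hasGoodReductionAtPrime_of_not_dvd W 7 (by rw [minimalDiscriminantInt_eq hIW, hΔ]; decide +kernel)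
  have hap : W.frobeniusTrace 7 = 0 := by rw [frobeniusTrace_eq hIW card_t245456b1_7]; norm_num
  have hX : ClassX7 W 7 :=
    ⟨⟨hgood, by rw [hap]; exact dvd_zero _⟩, not_semistable_of_intModel hIW 23 (by norm_num) (by rw [hΔ]; decide +kernel)
      (by rw [hc₄]; decide +kernel)⟩
  haveI : Fact (Nat.Prime 29) := ⟨by norm_num⟩
  have hsplit : W.HasSplitMultiplicativeReductionAtPrime 29 :=
    EisensteinPrimesMazurMCOnCellBKernelCertP13TwoUnits.hasSplitMultiplicativeReductionAtPrime_of_natRoot W hIW 29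
      (by decide +kernel) (by decide +kernel) 2 (by decide +kernel)
  exact classX7_and_forall_kobayashiLowerDivisibility_of_split_of_mazurTateRows W 7 hJ h12 h41 hK13 hK08 h5 h3 hmod hGZK
    (by norm_num) hX hap hs hr (by decide) hrowE (by decide) hrowO hsplit

/-- **Crux L's body at the tier-T2 pair `245456c1 @ 7` by the SPLIT CLOSER — NO partner** (Cremona model `[0, 1, 0, -162533, -51299309]`, `N = 245456 = 2⁴·23²·29`, X7 (additive at
`23`), `a_7 = 0`, mod-`7` image `7Nn` (k3-c4 census; no CM elliptic-curve partner), analytic rank `0`, `#tors = 1`, `∏c = 14`, `#Ш_an = 1`,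
`L(E,1)/Ω_E = 14`; ONE multiplicative prime `q = 29`, `ord_q(Δ) = 7`, SPLIT): `ClassX7 W 7 ∧ ∀ ε, KobayashiLowerDivisibility W 7 ε` from print BY NAME
(`hJ h12 h41 hK13 hK08 h5 h3 hmod hGZK`) + displayed `r_an = 0` (`hr`), `¬ Surj W 7` (`hs`) and TWO displayed two-engine Mazur–Tate rows of kit
j335262 (`LAYERS.tsv` rows `245456c1@7`: index 2, even, `μ = 0, λ = 8 = 6 + 2` ⇒ `hrowE`; index 1, odd, `μ = 0, λ = 2 = 0 + 2` ⇒ `hrowO`;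
engines B and E AGREE) ⇒ `(μ, λ)(L^±_7) = (0, 2)`. Kernel-decided: `7 ∤ Δ`, `#Ẽ(𝔽_7) = 8` (`card_t245456c1_7`), `23 ∣ Δ, c₄` (X7), and the split
certificate at `q = 29`: `q ∣ Δ`, `q ∤ c₄`, node-tangent root `t = 7` (`hasSplitMultiplicativeReductionAtPrime_of_natRoot`). Per pair;
CONDITIONAL; nothing booked. [cite: Kobayashi2003, Conjecture (p. 2), Thm. 1.2, Thm. 4.1] [cite: KimBD2008MRL, Thm. 3.12 (p. 93)]
[cite: BDKim2013, Cor. 3.15 (p. 199)] [cite: Pollack2003, Prop. 6.18] [cite: SilvermanAEC2009, VII.5 Prop. 5.1(b)]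
[cite: Cremona2006, Table 1 (Cremona label 245456c1)] -/
theorem forall_kobayashiLowerDivisibility_t245456c1_7_of_split_of_mazurTateRows
    (hJ : thm62_63_73_signedColemanKato_zetaJoint) (h12 : thm12_signedSelmerDual_finite_torsion)
    (h41 : thm41_signedCharIdeal_divisibility) (hK13 : BDKim2013.cor315_signedCharValue_rankZero)
    (hK08 : Kim2008.thm312_signedSelmerDual_charIdeal_map_invol)
    (h5 : realPeriodRat_eq_unit_mul_plusPeriod) (h3 : realPeriodRat_eq_unit_mul_plusPeriod_three)
    (hmod : exists_isNewformOf) (hGZK : rank_eq_analyticRank_of_analyticRank_le_one)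
    (W : WeierstrassCurve ℚ) [W.IsElliptic] [W.IsGloballyMinimal] [Fact (Nat.Prime 7)] (hW : W = ⟨0, 1, 0, -162533, -51299309⟩)
    (hs : ¬ Surj W 7) (hr : W.analyticRank = 0)
    (hrowE : ∀ [NeZero (W.conductorNorm ℤ)] (f : CuspForm (Gamma0 (W.conductorNorm ℤ)) 2), IsNewformOf W f →
      ∃ Θ : IwasawaAlgebra 7, iwasawaToPowerSeries 7 Θ =
          ((mazurTateElement f 7 2).map (algebraMap ℚ ℚ_[7]) : PowerSeries ℚ_[7]) ∧
        Θ ≠ 0 ∧ mu Θ = 0 ∧ lam Θ = (cyclotomicOmegaMinus 7 2).natDegree + 2)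
    (hrowO : ∀ [NeZero (W.conductorNorm ℤ)] (f : CuspForm (Gamma0 (W.conductorNorm ℤ)) 2), IsNewformOf W f →
      ∃ Θ : IwasawaAlgebra 7, iwasawaToPowerSeries 7 Θ =
          ((mazurTateElement f 7 1).map (algebraMap ℚ ℚ_[7]) : PowerSeries ℚ_[7]) ∧
        Θ ≠ 0 ∧ mu Θ = 0 ∧ lam Θ = (cyclotomicOmegaPlus 7 1).natDegree + 2) :
    ClassX7 W 7 ∧ ∀ ε : ℤˣ, KobayashiLowerDivisibility W 7 ε := by
  have hIW : integralModelInt W = ⟨0, 1, 0, -162533, -51299309⟩ :=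
    integralModelInt_eq_of_map_eq _ (by rw [hW]; ext <;> simp [WeierstrassCurve.map])
  have hΔ : (⟨0, 1, 0, -162533, -51299309⟩ : WeierstrassCurve ℤ).Δ = discOf [0, 1, 0, -162533, -51299309] :=
    intCurve_Δ 0 1 0 (-162533) (-51299309)
  have hc₄ : (⟨0, 1, 0, -162533, -51299309⟩ : WeierstrassCurve ℤ).c₄ = c4Of [0, 1, 0, -162533, -51299309] :=
    intCurve_c₄ 0 1 0 (-162533) (-51299309)
  have hgood : W.HasGoodReductionAtPrime 7 :=
    hasGoodReductionAtPrime_of_not_dvd W 7 (by rw [minimalDiscriminantInt_eq hIW, hΔ]; decide +kernel)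
  have hap : W.frobeniusTrace 7 = 0 := by rw [frobeniusTrace_eq hIW card_t245456c1_7]; norm_num
  have hX : ClassX7 W 7 :=
    ⟨⟨hgood, by rw [hap]; exact dvd_zero _⟩, not_semistable_of_intModel hIW 23 (by norm_num) (by rw [hΔ]; decide +kernel)
      (by rw [hc₄]; decide +kernel)⟩
  haveI : Fact (Nat.Prime 29) := ⟨by norm_num⟩
  have hsplit : W.HasSplitMultiplicativeReductionAtPrime 29 :=
    EisensteinPrimesMazurMCOnCellBKernelCertP13TwoUnits.hasSplitMultiplicativeReductionAtPrime_of_natRoot W hIW 29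
      (by decide +kernel) (by decide +kernel) 7 (by decide +kernel)
  exact classX7_and_forall_kobayashiLowerDivisibility_of_split_of_mazurTateRows W 7 hJ h12 h41 hK13 hK08 h5 h3 hmod hGZK
    (by norm_num) hX hap hs hr (by decide) hrowE (by decide) hrowO hsplit

/-- **Crux L's body at the tier-T2 pair `353925ce1 @ 7` by the SPLIT CLOSER — NO partner** (Cremona model `[0, 0, 1, 147741000, 99524485156]`, `N = 353925 = 3²·5²·11²·13`, X7 (additive at
`11`), `a_7 = 0`, mod-`7` image `7Nn` (k3-c4 census; no CM elliptic-curve partner), analytic rank `0`, `#tors = 1`, `∏c = 56`, `#Ш_an = 1`,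
`L(E,1)/Ω_E = 56`; ONE multiplicative prime `q = 13`, `ord_q(Δ) = 7`, SPLIT): `ClassX7 W 7 ∧ ∀ ε, KobayashiLowerDivisibility W 7 ε` from print BY NAME
(`hJ h12 h41 hK13 hK08 h5 h3 hmod hGZK`) + displayed `r_an = 0` (`hr`), `¬ Surj W 7` (`hs`) and TWO displayed two-engine Mazur–Tate rows of kit
j335262 (`LAYERS.tsv` rows `353925ce1@7`: index 2, even, `μ = 0, λ = 8 = 6 + 2` ⇒ `hrowE`; index 1, odd, `μ = 0, λ = 2 = 0 + 2` ⇒ `hrowO`;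
engines B and E AGREE) ⇒ `(μ, λ)(L^±_7) = (0, 2)`. Kernel-decided: `7 ∤ Δ`, `#Ẽ(𝔽_7) = 8` (`card_t353925ce1_7`), `11 ∣ Δ, c₄` (X7), and the split
certificate at `q = 13`: `q ∣ Δ`, `q ∤ c₄`, node-tangent root `t = 1` (`hasSplitMultiplicativeReductionAtPrime_of_natRoot`). Per pair;
CONDITIONAL; nothing booked. [cite: Kobayashi2003, Conjecture (p. 2), Thm. 1.2, Thm. 4.1] [cite: KimBD2008MRL, Thm. 3.12 (p. 93)]
[cite: BDKim2013, Cor. 3.15 (p. 199)] [cite: Pollack2003, Prop. 6.18] [cite: SilvermanAEC2009, VII.5 Prop. 5.1(b)]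
[cite: Cremona2006, Table 1 (Cremona label 353925ce1)] -/
theorem forall_kobayashiLowerDivisibility_t353925ce1_7_of_split_of_mazurTateRows
    (hJ : thm62_63_73_signedColemanKato_zetaJoint) (h12 : thm12_signedSelmerDual_finite_torsion)
    (h41 : thm41_signedCharIdeal_divisibility) (hK13 : BDKim2013.cor315_signedCharValue_rankZero)
    (hK08 : Kim2008.thm312_signedSelmerDual_charIdeal_map_invol)
    (h5 : realPeriodRat_eq_unit_mul_plusPeriod) (h3 : realPeriodRat_eq_unit_mul_plusPeriod_three)
    (hmod : exists_isNewformOf) (hGZK : rank_eq_analyticRank_of_analyticRank_le_one)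
    (W : WeierstrassCurve ℚ) [W.IsElliptic] [W.IsGloballyMinimal] [Fact (Nat.Prime 7)] (hW : W = ⟨0, 0, 1, 147741000, 99524485156⟩)
    (hs : ¬ Surj W 7) (hr : W.analyticRank = 0)
    (hrowE : ∀ [NeZero (W.conductorNorm ℤ)] (f : CuspForm (Gamma0 (W.conductorNorm ℤ)) 2), IsNewformOf W f →
      ∃ Θ : IwasawaAlgebra 7, iwasawaToPowerSeries 7 Θ =
          ((mazurTateElement f 7 2).map (algebraMap ℚ ℚ_[7]) : PowerSeries ℚ_[7]) ∧
        Θ ≠ 0 ∧ mu Θ = 0 ∧ lam Θ = (cyclotomicOmegaMinus 7 2).natDegree + 2)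
    (hrowO : ∀ [NeZero (W.conductorNorm ℤ)] (f : CuspForm (Gamma0 (W.conductorNorm ℤ)) 2), IsNewformOf W f →
      ∃ Θ : IwasawaAlgebra 7, iwasawaToPowerSeries 7 Θ =
          ((mazurTateElement f 7 1).map (algebraMap ℚ ℚ_[7]) : PowerSeries ℚ_[7]) ∧
        Θ ≠ 0 ∧ mu Θ = 0 ∧ lam Θ = (cyclotomicOmegaPlus 7 1).natDegree + 2) :
    ClassX7 W 7 ∧ ∀ ε : ℤˣ, KobayashiLowerDivisibility W 7 ε := by
  have hIW : integralModelInt W = ⟨0, 0, 1, 147741000, 99524485156⟩ :=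
    integralModelInt_eq_of_map_eq _ (by rw [hW]; ext <;> simp [WeierstrassCurve.map])
  have hΔ : (⟨0, 0, 1, 147741000, 99524485156⟩ : WeierstrassCurve ℤ).Δ = discOf [0, 0, 1, 147741000, 99524485156] :=
    intCurve_Δ 0 0 1 147741000 99524485156
  have hc₄ : (⟨0, 0, 1, 147741000, 99524485156⟩ : WeierstrassCurve ℤ).c₄ = c4Of [0, 0, 1, 147741000, 99524485156] :=
    intCurve_c₄ 0 0 1 147741000 99524485156
  have hgood : W.HasGoodReductionAtPrime 7 :=
    hasGoodReductionAtPrime_of_not_dvd W 7 (by rw [minimalDiscriminantInt_eq hIW, hΔ]; decide +kernel)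
  have hap : W.frobeniusTrace 7 = 0 := by rw [frobeniusTrace_eq hIW card_t353925ce1_7]; norm_num
  have hX : ClassX7 W 7 :=
    ⟨⟨hgood, by rw [hap]; exact dvd_zero _⟩, not_semistable_of_intModel hIW 11 (by norm_num) (by rw [hΔ]; decide +kernel)
      (by rw [hc₄]; decide +kernel)⟩
  haveI : Fact (Nat.Prime 13) := ⟨by norm_num⟩
  have hsplit : W.HasSplitMultiplicativeReductionAtPrime 13 :=
    EisensteinPrimesMazurMCOnCellBKernelCertP13TwoUnits.hasSplitMultiplicativeReductionAtPrime_of_natRoot W hIW 13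
      (by decide +kernel) (by decide +kernel) 1 (by decide +kernel)
  exact classX7_and_forall_kobayashiLowerDivisibility_of_split_of_mazurTateRows W 7 hJ h12 h41 hK13 hK08 h5 h3 hmod hGZK
    (by norm_num) hX hap hs hr (by decide) hrowE (by decide) hrowO hsplit

/-- **Crux L's body at the tier-T2 pair `232544i1 @ 11` by the SPLIT CLOSER — NO partner** (Cremona model `[0, 0, 0, -6682520, 39157150032]`, `N = 232544 = 2⁵·13²·43`, X7 (additive at
`13`), `a_11 = 0`, mod-`11` image `11Nn` (k3-c4 census; no CM elliptic-curve partner), analytic rank `0`, `#tors = 1`, `∏c = 22`, `#Ш_an = 1`,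
`L(E,1)/Ω_E = 22`; ONE multiplicative prime `q = 43`, `ord_q(Δ) = 11`, SPLIT): `ClassX7 W 11 ∧ ∀ ε, KobayashiLowerDivisibility W 11 ε` from print BY NAME
(`hJ h12 h41 hK13 hK08 h5 h3 hmod hGZK`) + displayed `r_an = 0` (`hr`), `¬ Surj W 11` (`hs`) and TWO displayed two-engine Mazur–Tate rows of kit
j335262 (`LAYERS.tsv` rows `232544i1@11`: index 2, even, `μ = 0, λ = 12 = 10 + 2` ⇒ `hrowE`; index 1, odd, `μ = 0, λ = 2 = 0 + 2` ⇒ `hrowO`;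
engines B and E AGREE) ⇒ `(μ, λ)(L^±_11) = (0, 2)`. Kernel-decided: `11 ∤ Δ`, `#Ẽ(𝔽_11) = 12` (`card_t232544i1_11`), `13 ∣ Δ, c₄` (X7), and the split
certificate at `q = 43`: `q ∣ Δ`, `q ∤ c₄`, node-tangent root `t = 15` (`hasSplitMultiplicativeReductionAtPrime_of_natRoot`). Per pair;
CONDITIONAL; nothing booked. [cite: Kobayashi2003, Conjecture (p. 2), Thm. 1.2, Thm. 4.1] [cite: KimBD2008MRL, Thm. 3.12 (p. 93)]
[cite: BDKim2013, Cor. 3.15 (p. 199)] [cite: Pollack2003, Prop. 6.18] [cite: SilvermanAEC2009, VII.5 Prop. 5.1(b)]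
[cite: Cremona2006, Table 1 (Cremona label 232544i1)] -/
theorem forall_kobayashiLowerDivisibility_t232544i1_11_of_split_of_mazurTateRows
    (hJ : thm62_63_73_signedColemanKato_zetaJoint) (h12 : thm12_signedSelmerDual_finite_torsion)
    (h41 : thm41_signedCharIdeal_divisibility) (hK13 : BDKim2013.cor315_signedCharValue_rankZero)
    (hK08 : Kim2008.thm312_signedSelmerDual_charIdeal_map_invol)
    (h5 : realPeriodRat_eq_unit_mul_plusPeriod) (h3 : realPeriodRat_eq_unit_mul_plusPeriod_three)
    (hmod : exists_isNewformOf) (hGZK : rank_eq_analyticRank_of_analyticRank_le_one)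
    (W : WeierstrassCurve ℚ) [W.IsElliptic] [W.IsGloballyMinimal] [Fact (Nat.Prime 11)] (hW : W = ⟨0, 0, 0, -6682520, 39157150032⟩)
    (hs : ¬ Surj W 11) (hr : W.analyticRank = 0)
    (hrowE : ∀ [NeZero (W.conductorNorm ℤ)] (f : CuspForm (Gamma0 (W.conductorNorm ℤ)) 2), IsNewformOf W f →
      ∃ Θ : IwasawaAlgebra 11, iwasawaToPowerSeries 11 Θ =
          ((mazurTateElement f 11 2).map (algebraMap ℚ ℚ_[11]) : PowerSeries ℚ_[11]) ∧
        Θ ≠ 0 ∧ mu Θ = 0 ∧ lam Θ = (cyclotomicOmegaMinus 11 2).natDegree + 2)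
    (hrowO : ∀ [NeZero (W.conductorNorm ℤ)] (f : CuspForm (Gamma0 (W.conductorNorm ℤ)) 2), IsNewformOf W f →
      ∃ Θ : IwasawaAlgebra 11, iwasawaToPowerSeries 11 Θ =
          ((mazurTateElement f 11 1).map (algebraMap ℚ ℚ_[11]) : PowerSeries ℚ_[11]) ∧
        Θ ≠ 0 ∧ mu Θ = 0 ∧ lam Θ = (cyclotomicOmegaPlus 11 1).natDegree + 2) :
    ClassX7 W 11 ∧ ∀ ε : ℤˣ, KobayashiLowerDivisibility W 11 ε := by
  have hIW : integralModelInt W = ⟨0, 0, 0, -6682520, 39157150032⟩ :=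
    integralModelInt_eq_of_map_eq _ (by rw [hW]; ext <;> simp [WeierstrassCurve.map])
  have hΔ : (⟨0, 0, 0, -6682520, 39157150032⟩ : WeierstrassCurve ℤ).Δ = discOf [0, 0, 0, -6682520, 39157150032] :=
    intCurve_Δ 0 0 0 (-6682520) 39157150032
  have hc₄ : (⟨0, 0, 0, -6682520, 39157150032⟩ : WeierstrassCurve ℤ).c₄ = c4Of [0, 0, 0, -6682520, 39157150032] :=
    intCurve_c₄ 0 0 0 (-6682520) 39157150032
  have hgood : W.HasGoodReductionAtPrime 11 :=
    hasGoodReductionAtPrime_of_not_dvd W 11 (by rw [minimalDiscriminantInt_eq hIW, hΔ]; decide +kernel)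
  have hap : W.frobeniusTrace 11 = 0 := by rw [frobeniusTrace_eq hIW card_t232544i1_11]; norm_num
  have hX : ClassX7 W 11 :=
    ⟨⟨hgood, by rw [hap]; exact dvd_zero _⟩, not_semistable_of_intModel hIW 13 (by norm_num) (by rw [hΔ]; decide +kernel)
      (by rw [hc₄]; decide +kernel)⟩
  haveI : Fact (Nat.Prime 43) := ⟨by norm_num⟩
  have hsplit : W.HasSplitMultiplicativeReductionAtPrime 43 :=
    EisensteinPrimesMazurMCOnCellBKernelCertP13TwoUnits.hasSplitMultiplicativeReductionAtPrime_of_natRoot W hIW 43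
      (by decide +kernel) (by decide +kernel) 15 (by decide +kernel)
  exact classX7_and_forall_kobayashiLowerDivisibility_of_split_of_mazurTateRows W 11 hJ h12 h41 hK13 hK08 h5 h3 hmod hGZK
    (by norm_num) hX hap hs hr (by decide) hrowE (by decide) hrowO hsplit

end Summit.BirchSwinnertonDyer.BirchSwinnertonDyer.Theorems.SmallImageRttOneSided

end
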